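import Summits.ResolutionOfSingularities.ResolutionOfSingularities.Theorems.EquisingularLiftEquisingularLiftNatSecondOrderA3Recognition
import HarnessLib

/-!
# [OURS] THE `D₄` POINT `x² + y³ + z³` IN POLYNOMIAL CURRENCY: strict transforms, the MARKED Jacobian datum (three exceptional `A₁` points, none a chart
# origin) and one-step data of the translates — the polynomial input of the multi-root level-1 bridge (✓ …NatMarkedCharts / …NatMarkedTwoStep / …NatMarkedVertex)
# (cruxes `Theses.EquisingularLift.EquisingularLiftNat` / `…NatThree` / `EquisingularLift`, stmt-ResolutionOfSingularities-20038 / -20148 / -15660)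

[OURS · leafhand-res-equisingularlift-12 g0, 2026-08-31; cell `pub/decomp-res`] AI-produced, weaker than expert review; NOT a statement of any manuscript;
nothing here proves resolution of singularities in positive characteristic.  DEF-FREE helper; no `sorry`; standard axioms; ZERO named hypotheses.

The specimen `f = y₀² + (y₁³ + y₂³)` (tangent cone the DOUBLE PLANE `y₀²`, `μ = 2`; a `D₄` rational double point when `6 ≠ 0`) over a field `K` with `2 ≠ 0`,
`3 ≠ 0` and three elements `ζ₀, ζ₁, ζ₂` splitting `t³ + 1 = (t − ζ₀)(t − ζ₁)(t − ζ₂)` (so `ζ_k³ = −1`):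

* `D₄_strictTransform` — the three strict transforms `G₀ = 1 + T₀(T₁³ + T₂³)` (no exceptional point), `G₁ = T₀² + T₁(1 + T₂³)`, `G₂ = T₀² + T₂(1 + T₁³)`;
* `D₄_jac₀/₁/₂` — the MARKED Jacobian datum: a prime `P ∋ T_a, G_a` containing all `∂_jG_a` contains the mark `(T₀, T₁, T₂ − ζ_k)` (chart `1`) /
  `(T₀, T₁ − ζ_k, T₂)` (chart `2`) for some `k`; chart `0` has no such prime;
* `D₄_translate₁/₂` — the translates `G₁(T + (0,0,ζ)) = (T₀² + 3ζ²·T₁T₂) + (3ζ·T₁T₂² + T₁T₂³)`, `G₂(T + (0,ζ,0)) = (T₀² + 3ζ²·T₁T₂) + (3ζ·T₁²T₂ + T₁³T₂)`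
  for `ζ³ = −1`: tangent cone the NON-DEGENERATE quadric `T₀² + 3ζ²T₁T₂` — an `A₁`;
* `D₄_exceptional_firstOrder` — the prime-ideal first-order criterion for `T₀² + c·T₁T₂` (`2c ≠ 0`), whence one-step data for the translates by
  ✓ `FirstOrderPoint.exists_strictTransform`;
* ★★★ `twoStepData_D₄_marked` — everything packaged VERBATIM as the hypotheses `hΨ, G, hG, Λ, hjac, hsec` of ✓ `OneStep.twoStepAt_origin_marked` /
  ✓ `twoStepAt_vertex_marked` (marks `Λ 0 = ∅`, `Λ 1 = {(0,0,ζ_k)}`, `Λ 2 = {(0,ζ_k,0)}`).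

Honest label: pure algebra; closes no registered stub (with ✓ `twoStepAt_vertex_marked` and the vertex bookkeeping it certifies `D₄` vertices as TWO-STEP,
hence outside the isolated residual's `¬ IsoHypPoint`).

References: [Hartshorne1977, I Thm. 5.1, I Ex. 5.6, II Ex. 7.12]; `D₄ → 3A₁ → ∅` under point blow-ups (classical, e.g. [Lipman1969, §24]); through the cited tree files.
-/

set_option linter.dupNamespace false -- mandated namespace `Summit.<Summit>.<Problem>` of this single-conjunct summit

noncomputable section

open MvPolynomial

namespace Summit.ResolutionOfSingularities.ResolutionOfSingularities.Cruxes.EquisingularLiftNat.Sections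

namespace SecondOrderPoint

variable (K : Type) [Field K]

/-! ## The strict transforms of `f = y₀² + (y₁³ + y₂³)` -/

/-- **The three strict transforms of the `D₄` specimen** (total-transform identities, `μ = 2`). [cite: Hartshorne1977, II Ex. 7.12] -/
theorem D₄_strictTransform :
    aeval (fun j => X 0 * Function.update (X : Fin 3 → MvPolynomial (Fin 3) K) 0 1 j) (X 0 ^ 2 + (X 1 ^ 3 + X 2 ^ 3) : MvPolynomial (Fin 3) K) =
      X 0 ^ 2 * (1 + X 0 * (X 1 ^ 3 + X 2 ^ 3)) ∧
    aeval (fun j => X 1 * Function.update (X : Fin 3 → MvPolynomial (Fin 3) K) 1 1 j) (X 0 ^ 2 + (X 1 ^ 3 + X 2 ^ 3) : MvPolynomial (Fin 3) K) =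
      X 1 ^ 2 * (X 0 ^ 2 + X 1 * (1 + X 2 ^ 3)) ∧
    aeval (fun j => X 2 * Function.update (X : Fin 3 → MvPolynomial (Fin 3) K) 2 1 j) (X 0 ^ 2 + (X 1 ^ 3 + X 2 ^ 3) : MvPolynomial (Fin 3) K) =
      X 2 ^ 2 * (X 0 ^ 2 + X 2 * (1 + X 1 ^ 3)) := by
  refine ⟨?_, ?_, ?_⟩
  · simp only [map_add, map_pow, aeval_X, Function.update_self, Function.update_of_ne (by decide : (1 : Fin 3) ≠ 0),
      Function.update_of_ne (by decide : (2 : Fin 3) ≠ 0)]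
    ring
  · simp only [map_add, map_pow, aeval_X, Function.update_self, Function.update_of_ne (by decide : (0 : Fin 3) ≠ 1),
      Function.update_of_ne (by decide : (2 : Fin 3) ≠ 1)]
    ring
  · simp only [map_add, map_pow, aeval_X, Function.update_self, Function.update_of_ne (by decide : (0 : Fin 3) ≠ 2),
      Function.update_of_ne (by decide : (1 : Fin 3) ≠ 2)]
    ring

/-- `y₁³ + y₂³ ∈ (y)³`. [folklore] -/
theorem D₄_tail_mem_pow : (X 1 ^ 3 + X 2 ^ 3 : MvPolynomial (Fin 3) K) ∈ Ideal.span (Set.range (X : Fin 3 → MvPolynomial (Fin 3) K)) ^ 3 :=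
  Ideal.add_mem _ (Ideal.pow_mem_pow (Ideal.subset_span (Set.mem_range_self (1 : Fin 3))) 3)
    (Ideal.pow_mem_pow (Ideal.subset_span (Set.mem_range_self (2 : Fin 3))) 3)

/-! ## Partial derivatives -/

/-- The partials of `G₁ = T₀² + T₁(1 + T₂³)`. [folklore] -/
theorem D₄_pderiv₁ :
    pderiv 0 (X 0 ^ 2 + X 1 * (1 + X 2 ^ 3) : MvPolynomial (Fin 3) K) = C 2 * X 0 ∧
    pderiv 1 (X 0 ^ 2 + X 1 * (1 + X 2 ^ 3) : MvPolynomial (Fin 3) K) = 1 + X 2 ^ 3 := by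
  refine ⟨?_, ?_⟩
  · rw [map_add, pderiv_pow, pderiv_X_self, pderiv_mul, pderiv_X_of_ne (by decide : (1 : Fin 3) ≠ 0), map_add, pderiv_one, pderiv_pow,
      pderiv_X_of_ne (by decide : (2 : Fin 3) ≠ 0), map_ofNat]
    ring
  · rw [map_add, pderiv_pow, pderiv_X_of_ne (by decide : (0 : Fin 3) ≠ 1), pderiv_mul, pderiv_X_self, map_add, pderiv_one, pderiv_pow,
      pderiv_X_of_ne (by decide : (2 : Fin 3) ≠ 1)]
    ring

/-- The partials of `G₂ = T₀² + T₂(1 + T₁³)`. [folklore] -/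
theorem D₄_pderiv₂ :
    pderiv 0 (X 0 ^ 2 + X 2 * (1 + X 1 ^ 3) : MvPolynomial (Fin 3) K) = C 2 * X 0 ∧
    pderiv 2 (X 0 ^ 2 + X 2 * (1 + X 1 ^ 3) : MvPolynomial (Fin 3) K) = 1 + X 1 ^ 3 := by
  refine ⟨?_, ?_⟩
  · rw [map_add, pderiv_pow, pderiv_X_self, pderiv_mul, pderiv_X_of_ne (by decide : (2 : Fin 3) ≠ 0), map_add, pderiv_one, pderiv_pow,
      pderiv_X_of_ne (by decide : (1 : Fin 3) ≠ 0), map_ofNat]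
    ring
  · rw [map_add, pderiv_pow, pderiv_X_of_ne (by decide : (0 : Fin 3) ≠ 2), pderiv_mul, pderiv_X_self, map_add, pderiv_one, pderiv_pow,
      pderiv_X_of_ne (by decide : (1 : Fin 3) ≠ 2)]
    ring

/-- The partials of the exceptional tangent cone `T₀² + c·T₁T₂`. [folklore] -/
theorem D₄_pderiv_cone (c : K) :
    pderiv 0 (X 0 ^ 2 + C c * (X 1 * X 2) : MvPolynomial (Fin 3) K) = C 2 * X 0 ∧
    pderiv 1 (X 0 ^ 2 + C c * (X 1 * X 2) : MvPolynomial (Fin 3) K) = C c * X 2 ∧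
    pderiv 2 (X 0 ^ 2 + C c * (X 1 * X 2) : MvPolynomial (Fin 3) K) = C c * X 1 := by
  refine ⟨?_, ?_, ?_⟩
  · rw [map_add, pderiv_pow, pderiv_X_self, pderiv_C_mul, pderiv_mul, pderiv_X_of_ne (by decide : (1 : Fin 3) ≠ 0),
      pderiv_X_of_ne (by decide : (2 : Fin 3) ≠ 0), map_ofNat]
    ring
  · rw [map_add, pderiv_pow, pderiv_X_of_ne (by decide : (0 : Fin 3) ≠ 1), pderiv_C_mul, pderiv_mul, pderiv_X_self,
      pderiv_X_of_ne (by decide : (2 : Fin 3) ≠ 1)]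
    ring
  · rw [map_add, pderiv_pow, pderiv_X_of_ne (by decide : (0 : Fin 3) ≠ 2), pderiv_C_mul, pderiv_mul, pderiv_X_of_ne (by decide : (1 : Fin 3) ≠ 2),
      pderiv_X_self]
    ring

/-! ## The marked Jacobian datum -/

/-- **Chart `0` carries no point over the vertex**: a prime containing `T₀` and `G₀ = 1 + T₀·R` contains `1`. [folklore] -/
theorem D₄_jac₀ (P : Ideal (MvPolynomial (Fin 3) K)) (hP : P.IsPrime) (h0 : (X 0 : MvPolynomial (Fin 3) K) ∈ P)
    (hG : (1 + X 0 * (X 1 ^ 3 + X 2 ^ 3) : MvPolynomial (Fin 3) K) ∈ P) : False := by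
  apply hP.ne_top
  rw [Ideal.eq_top_iff_one]
  have e : (1 : MvPolynomial (Fin 3) K) = (1 + X 0 * (X 1 ^ 3 + X 2 ^ 3)) - X 0 * (X 1 ^ 3 + X 2 ^ 3) := by ring
  rw [e]
  exact P.sub_mem hG (P.mul_mem_right _ h0)

/-- **Chart `1`: a singular prime over the vertex contains a mark `(T₀, T₁, T₂ − ζ_k)`** (`2 ≠ 0`; `t³ + 1 = ∏ (t − ζ_k)`). [cite: Hartshorne1977, I Thm. 5.1] -/
theorem D₄_jac₁ (h2 : (2 : K) ≠ 0) (ζ : Fin 3 → K)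
    (hfac : ((X 2 - C (ζ 0)) * (X 2 - C (ζ 1)) * (X 2 - C (ζ 2)) : MvPolynomial (Fin 3) K) = X 2 ^ 3 + 1)
    (Λ₁ : Finset (Fin 3 → K)) (hΛ₁ : ∀ k, (Pi.single (2 : Fin 3) (ζ k) : Fin 3 → K) ∈ Λ₁)
    (P : Ideal (MvPolynomial (Fin 3) K)) (hP : P.IsPrime) (h1 : (X 1 : MvPolynomial (Fin 3) K) ∈ P)
    (_hG : (X 0 ^ 2 + X 1 * (1 + X 2 ^ 3) : MvPolynomial (Fin 3) K) ∈ P) :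
    (∃ j, pderiv j (X 0 ^ 2 + X 1 * (1 + X 2 ^ 3) : MvPolynomial (Fin 3) K) ∉ P) ∨
      ∃ lam ∈ Λ₁, ∀ i, (X i - C (lam i) : MvPolynomial (Fin 3) K) ∈ P := by
  classical
  by_cases hall : ∀ j, pderiv j (X 0 ^ 2 + X 1 * (1 + X 2 ^ 3) : MvPolynomial (Fin 3) K) ∈ P
  · right
    obtain ⟨hd0, hd1⟩ := D₄_pderiv₁ K
    have hX0 : (X 0 : MvPolynomial (Fin 3) K) ∈ P := mem_of_C_mul_mem K h2 P hP (by rw [← hd0]; exact hall 0)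
    have hcub : ((X 2 - C (ζ 0)) * (X 2 - C (ζ 1)) * (X 2 - C (ζ 2)) : MvPolynomial (Fin 3) K) ∈ P := by
      rw [hfac, add_comm, ← hd1]; exact hall 1
    have hk : ∃ k : Fin 3, (X 2 - C (ζ k) : MvPolynomial (Fin 3) K) ∈ P := by
      rcases hP.mem_or_mem hcub with h01 | h2'
      · rcases hP.mem_or_mem h01 with h0' | h1'
        · exact ⟨0, h0'⟩
        · exact ⟨1, h1'⟩
      · exact ⟨2, h2'⟩
    obtain ⟨k, hk⟩ := hk
    refine ⟨Pi.single (2 : Fin 3) (ζ k), hΛ₁ k, fun i => ?_⟩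
    fin_cases i
    · simpa using hX0
    · simpa using h1
    · simpa using hk
  · left
    push Not at hall
    exact hall

/-- **Chart `2`: a singular prime over the vertex contains a mark `(T₀, T₁ − ζ_k, T₂)`.** [cite: Hartshorne1977, I Thm. 5.1] -/
theorem D₄_jac₂ (h2 : (2 : K) ≠ 0) (ζ : Fin 3 → K)
    (hfac : ((X 1 - C (ζ 0)) * (X 1 - C (ζ 1)) * (X 1 - C (ζ 2)) : MvPolynomial (Fin 3) K) = X 1 ^ 3 + 1)
    (Λ₂ : Finset (Fin 3 → K)) (hΛ₂ : ∀ k, (Pi.single (1 : Fin 3) (ζ k) : Fin 3 → K) ∈ Λ₂)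
    (P : Ideal (MvPolynomial (Fin 3) K)) (hP : P.IsPrime) (h2m : (X 2 : MvPolynomial (Fin 3) K) ∈ P)
    (_hG : (X 0 ^ 2 + X 2 * (1 + X 1 ^ 3) : MvPolynomial (Fin 3) K) ∈ P) :
    (∃ j, pderiv j (X 0 ^ 2 + X 2 * (1 + X 1 ^ 3) : MvPolynomial (Fin 3) K) ∉ P) ∨
      ∃ lam ∈ Λ₂, ∀ i, (X i - C (lam i) : MvPolynomial (Fin 3) K) ∈ P := by
  classical
  by_cases hall : ∀ j, pderiv j (X 0 ^ 2 + X 2 * (1 + X 1 ^ 3) : MvPolynomial (Fin 3) K) ∈ P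
  · right
    obtain ⟨hd0, hd2⟩ := D₄_pderiv₂ K
    have hX0 : (X 0 : MvPolynomial (Fin 3) K) ∈ P := mem_of_C_mul_mem K h2 P hP (by rw [← hd0]; exact hall 0)
    have hcub : ((X 1 - C (ζ 0)) * (X 1 - C (ζ 1)) * (X 1 - C (ζ 2)) : MvPolynomial (Fin 3) K) ∈ P := by
      rw [hfac, add_comm, ← hd2]; exact hall 2
    have hk : ∃ k : Fin 3, (X 1 - C (ζ k) : MvPolynomial (Fin 3) K) ∈ P := by
      rcases hP.mem_or_mem hcub with h01 | h2'
      · rcases hP.mem_or_mem h01 with h0' | h1'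
        · exact ⟨0, h0'⟩
        · exact ⟨1, h1'⟩
      · exact ⟨2, h2'⟩
    obtain ⟨k, hk⟩ := hk
    refine ⟨Pi.single (1 : Fin 3) (ζ k), hΛ₂ k, fun i => ?_⟩
    fin_cases i
    · simpa using hX0
    · simpa using hk
    · simpa using h2m
  · left
    push Not at hall
    exact hall

/-! ## The translates at the marks: `A₁` points -/

/-- **Chart `1` translated to the mark `(0,0,ζ)`, `ζ³ = −1`**: `G₁(T₀, T₁, T₂ + ζ) = (T₀² + 3ζ²T₁T₂) + (3ζT₁T₂² + T₁T₂³)`. [folklore] -/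
theorem D₄_translate₁ (ζ : K) (hζ : ζ ^ 3 = -1) :
    aeval (fun i => X i + C ((Pi.single (2 : Fin 3) ζ : Fin 3 → K) i)) (X 0 ^ 2 + X 1 * (1 + X 2 ^ 3) : MvPolynomial (Fin 3) K) =
      (X 0 ^ 2 + C (3 * ζ ^ 2) * (X 1 * X 2)) + (C (3 * ζ) * (X 1 * X 2 ^ 2) + X 1 * X 2 ^ 3) := by
  have hC : (C ζ : MvPolynomial (Fin 3) K) ^ 3 = -1 := by rw [← map_pow, hζ, map_neg, map_one]
  simp only [map_add, map_mul, map_pow, map_one, aeval_X, Pi.single_eq_same, Pi.single_eq_of_ne (by decide : (0 : Fin 3) ≠ 2),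
    Pi.single_eq_of_ne (by decide : (1 : Fin 3) ≠ 2), map_zero, add_zero, map_ofNat]
  linear_combination (X 1 : MvPolynomial (Fin 3) K) * hC

/-- **Chart `2` translated to the mark `(0,ζ,0)`, `ζ³ = −1`**: `G₂(T₀, T₁ + ζ, T₂) = (T₀² + 3ζ²T₁T₂) + (3ζT₁²T₂ + T₁³T₂)`. [folklore] -/
theorem D₄_translate₂ (ζ : K) (hζ : ζ ^ 3 = -1) :
    aeval (fun i => X i + C ((Pi.single (1 : Fin 3) ζ : Fin 3 → K) i)) (X 0 ^ 2 + X 2 * (1 + X 1 ^ 3) : MvPolynomial (Fin 3) K) =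
      (X 0 ^ 2 + C (3 * ζ ^ 2) * (X 1 * X 2)) + (C (3 * ζ) * (X 1 ^ 2 * X 2) + X 1 ^ 3 * X 2) := by
  have hC : (C ζ : MvPolynomial (Fin 3) K) ^ 3 = -1 := by rw [← map_pow, hζ, map_neg, map_one]
  simp only [map_add, map_mul, map_pow, map_one, aeval_X, Pi.single_eq_same, Pi.single_eq_of_ne (by decide : (0 : Fin 3) ≠ 1),
    Pi.single_eq_of_ne (by decide : (2 : Fin 3) ≠ 1), map_zero, add_zero, map_ofNat]
  linear_combination (X 2 : MvPolynomial (Fin 3) K) * hC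

/-- **The exceptional tangent cone `T₀² + c·T₁T₂` (`2c ≠ 0`) is first-order** (prime-ideal criterion: a prime containing its partials contains all `T_i`),
for ANY next form `Ψ₁`. [cite: Hartshorne1977, I Thm. 5.1] -/
theorem D₄_cone_firstOrder (h2 : (2 : K) ≠ 0) {c : K} (hc : c ≠ 0) (Ψ₁ : MvPolynomial (Fin 3) K)
    (P : Ideal (MvPolynomial (Fin 3) K)) (hP : P.IsPrime) (_hΦ : (X 0 ^ 2 + C c * (X 1 * X 2) : MvPolynomial (Fin 3) K) ∈ P)
    (hd : ∀ i, pderiv i (X 0 ^ 2 + C c * (X 1 * X 2) : MvPolynomial (Fin 3) K) ∈ P) (_hΨ : Ψ₁ ∈ P) (i : Fin 3) :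
    (X i : MvPolynomial (Fin 3) K) ∈ P := by
  obtain ⟨hd0, hd1, hd2⟩ := D₄_pderiv_cone K c
  have hX0 : (X 0 : MvPolynomial (Fin 3) K) ∈ P := mem_of_C_mul_mem K h2 P hP (by rw [← hd0]; exact hd 0)
  have hX1 : (X 1 : MvPolynomial (Fin 3) K) ∈ P := mem_of_C_mul_mem K hc P hP (by rw [← hd2]; exact hd 2)
  have hX2 : (X 2 : MvPolynomial (Fin 3) K) ∈ P := mem_of_C_mul_mem K hc P hP (by rw [← hd1]; exact hd 1)
  fin_cases i
  · simpa using hX0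
  · simpa using hX1
  · simpa using hX2

/-- The exceptional tangent cone is a NON-ZERO quadratic form. [folklore] -/
theorem D₄_cone_isHomogeneous_ne_zero (c : K) :
    (X 0 ^ 2 + C c * (X 1 * X 2) : MvPolynomial (Fin 3) K).IsHomogeneous 2 ∧ (X 0 ^ 2 + C c * (X 1 * X 2) : MvPolynomial (Fin 3) K) ≠ 0 := by
  refine ⟨?_, fun h => ?_⟩
  · refine (isHomogeneous_X_pow (0 : Fin 3) 2).add ?_
    simpa using (isHomogeneous_C (Fin 3) c).mul ((isHomogeneous_X K (1 : Fin 3)).mul (isHomogeneous_X K (2 : Fin 3)))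
  · have h1 := congrArg (eval (Pi.single (0 : Fin 3) (1 : K))) h
    simp at h1

/-- ★★ **ONE-STEP DATA FOR THE EXCEPTIONAL `A₁` POINTS**: for `Φ' = T₀² + c·T₁T₂` (`2c ≠ 0`), any cubic form `Ψ₁` and any `Ψ'' ∈ (T)⁴`, the point
`Φ' + (Ψ₁ + Ψ'')` carries the one-step datum (hone') (✓ `FirstOrderPoint.exists_strictTransform`). [cite: Hartshorne1977, I Thm. 5.1, II Ex. 7.12] -/
theorem D₄_exceptional_oneStep (h2 : (2 : K) ≠ 0) {c : K} (hc : c ≠ 0) (Ψ₁ Ψ'' : MvPolynomial (Fin 3) K) (hΨ₁ : Ψ₁.IsHomogeneous 3)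
    (hΨ'' : Ψ'' ∈ Ideal.span (Set.range (X : Fin 3 → MvPolynomial (Fin 3) K)) ^ 4) (b : Fin 3) :
    ∃ G' : MvPolynomial (Fin 3) K,
      aeval (fun j => X b * Function.update (X : Fin 3 → MvPolynomial (Fin 3) K) b 1 j) ((X 0 ^ 2 + C c * (X 1 * X 2)) + (Ψ₁ + Ψ'')) = X b ^ 2 * G' ∧
      ∀ P : Ideal (MvPolynomial (Fin 3) K), P.IsPrime → (X b : MvPolynomial (Fin 3) K) ∈ P → G' ∈ P → ∃ j, pderiv j G' ∉ P :=
  FirstOrderPoint.exists_strictTransform K (X 0 ^ 2 + C c * (X 1 * X 2)) Ψ₁ Ψ'' (D₄_cone_isHomogeneous_ne_zero K c).1 hΨ₁ hΨ''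
    (fun P hP hΦP hdP hΨP => D₄_cone_firstOrder K h2 hc Ψ₁ P hP hΦP hdP hΨP) b

/-! ## ★★★ The packaged marked two-step data -/

/-- ★★★ **THE MARKED TWO-STEP DATA OF THE `D₄` SPECIMEN `y₀² + (y₁³ + y₂³)`** — VERBATIM the hypotheses `hΨ`, `G, hG`, `Λ, hjac, hsec` of
✓ `OneStep.twoStepAt_origin_marked` / ✓ `twoStepAt_vertex_marked` (`μ = 2`, `Φ = y₀²`): marks `Λ 0 = ∅`, `Λ 1 = {(0,0,ζ_k)}`, `Λ 2 = {(0,ζ_k,0)}`, every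
translate an `A₁`.  Hypotheses: `2 ≠ 0`, `3 ≠ 0` in `K` and `ζ : Fin 3 → K` splitting `t³ + 1`. [OURS] [cite: Hartshorne1977, I Thm. 5.1, I Ex. 5.6, II Ex. 7.12] -/
theorem twoStepData_D₄_marked (h2 : (2 : K) ≠ 0) (h3 : (3 : K) ≠ 0) (ζ : Fin 3 → K) (hζ : ∀ k, ζ k ^ 3 = -1)
    (hfac : ∀ i : Fin 3, ((X i - C (ζ 0)) * (X i - C (ζ 1)) * (X i - C (ζ 2)) : MvPolynomial (Fin 3) K) = X i ^ 3 + 1) :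
    (X 1 ^ 3 + X 2 ^ 3 : MvPolynomial (Fin 3) K) ∈ Ideal.span (Set.range (X : Fin 3 → MvPolynomial (Fin 3) K)) ^ (2 + 1) ∧
    ∃ (G : Fin 3 → MvPolynomial (Fin 3) K) (Λ : Fin 3 → Finset (Fin 3 → K)),
      (∀ a, aeval (fun j => X a * Function.update (X : Fin 3 → MvPolynomial (Fin 3) K) a 1 j)
        (X 0 ^ 2 + (X 1 ^ 3 + X 2 ^ 3) : MvPolynomial (Fin 3) K) = X a ^ 2 * G a) ∧
      (∀ a, ∀ P : Ideal (MvPolynomial (Fin 3) K), P.IsPrime → (X a : MvPolynomial (Fin 3) K) ∈ P → G a ∈ P →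
        (∃ j, pderiv j (G a) ∉ P) ∨ ∃ lam ∈ Λ a, ∀ i, (X i - C (lam i) : MvPolynomial (Fin 3) K) ∈ P) ∧
      (∀ a, ∀ lam ∈ Λ a, G a ∈ Ideal.span (Set.range fun i : Fin 3 => (X i - C (lam i) : MvPolynomial (Fin 3) K)) →
        ∃ (μ' : ℕ) (Φ' Ψ' : MvPolynomial (Fin 3) K), 1 ≤ μ' ∧ Φ'.IsHomogeneous μ' ∧ Φ' ≠ 0 ∧
          Ψ' ∈ Ideal.span (Set.range (X : Fin 3 → MvPolynomial (Fin 3) K)) ^ (μ' + 1) ∧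
          aeval (fun i => X i + C (lam i)) (G a) = Φ' + Ψ' ∧
          ∀ b : Fin 3, ∃ G' : MvPolynomial (Fin 3) K,
            aeval (fun j => X b * Function.update (X : Fin 3 → MvPolynomial (Fin 3) K) b 1 j) (Φ' + Ψ') = X b ^ 2 * G' ∧
            ∀ P : Ideal (MvPolynomial (Fin 3) K), P.IsPrime → (X b : MvPolynomial (Fin 3) K) ∈ P → G' ∈ P → ∃ j, pderiv j G' ∉ P) := by
  classical
  obtain ⟨hG0, hG1, hG2⟩ := D₄_strictTransform K
  set I : Ideal (MvPolynomial (Fin 3) K) := Ideal.span (Set.range (X : Fin 3 → MvPolynomial (Fin 3) K)) with hI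
  have hX : ∀ i : Fin 3, (X i : MvPolynomial (Fin 3) K) ∈ I := fun i => Ideal.subset_span (Set.mem_range_self i)
  have hζ0 : ∀ k, ζ k ≠ 0 := fun k h => by
    have := hζ k
    rw [h] at this
    norm_num at this
  have hc : ∀ k, (3 * ζ k ^ 2 : K) ≠ 0 := fun k => mul_ne_zero h3 (pow_ne_zero 2 (hζ0 k))
  -- one-step data at a mark, both charts
  have hcone := fun k => D₄_cone_isHomogeneous_ne_zero K (3 * ζ k ^ 2)
  refine ⟨D₄_tail_mem_pow K, ![1 + X 0 * (X 1 ^ 3 + X 2 ^ 3), X 0 ^ 2 + X 1 * (1 + X 2 ^ 3), X 0 ^ 2 + X 2 * (1 + X 1 ^ 3)],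
    ![∅, Finset.univ.image fun k : Fin 3 => (Pi.single (2 : Fin 3) (ζ k) : Fin 3 → K),
      Finset.univ.image fun k : Fin 3 => (Pi.single (1 : Fin 3) (ζ k) : Fin 3 → K)], ?_, ?_, ?_⟩
  · intro a
    fin_cases a
    · exact hG0
    · exact hG1
    · exact hG2
  · intro a P hP haP hGP
    fin_cases a
    · exact (D₄_jac₀ K P hP haP hGP).elim
    · exact D₄_jac₁ K h2 ζ (hfac 2) _ (fun k => Finset.mem_image.mpr ⟨k, Finset.mem_univ _, rfl⟩) P hP haP hGP
    · exact D₄_jac₂ K h2 ζ (hfac 1) _ (fun k => Finset.mem_image.mpr ⟨k, Finset.mem_univ _, rfl⟩) P hP haP hGP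
  · intro a lam hlam _hGa
    fin_cases a
    · simp at hlam
    · obtain ⟨k, -, rfl⟩ := Finset.mem_image.mp hlam
      refine ⟨2, X 0 ^ 2 + C (3 * ζ k ^ 2) * (X 1 * X 2), C (3 * ζ k) * (X 1 * X 2 ^ 2) + X 1 * X 2 ^ 3, by norm_num, (hcone k).1, (hcone k).2,
        ?_, D₄_translate₁ K (ζ k) (hζ k), fun b => ?_⟩
      · refine Ideal.add_mem _ (Ideal.mul_mem_left _ _ ?_) ?_
        · have e : I ^ (2 + 1) = I * I ^ 2 := by rw [pow_succ']
          rw [e]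
          exact Ideal.mul_mem_mul (hX 1) (Ideal.pow_mem_pow (hX 2) 2)
        · refine Ideal.pow_le_pow_right (by norm_num : 2 + 1 ≤ 4) ?_
          have e : I ^ 4 = I * I ^ 3 := by rw [pow_succ']
          rw [e]
          exact Ideal.mul_mem_mul (hX 1) (Ideal.pow_mem_pow (hX 2) 3)
      · refine D₄_exceptional_oneStep K h2 (hc k) _ _ ?_ ?_ b
        · simpa using (isHomogeneous_C (Fin 3) (3 * ζ k)).mul ((isHomogeneous_X K (1 : Fin 3)).mul (isHomogeneous_X_pow (2 : Fin 3) 2))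
        · have e : I ^ 4 = I * I ^ 3 := by rw [pow_succ']
          rw [e]
          exact Ideal.mul_mem_mul (hX 1) (Ideal.pow_mem_pow (hX 2) 3)
    · obtain ⟨k, -, rfl⟩ := Finset.mem_image.mp hlam
      refine ⟨2, X 0 ^ 2 + C (3 * ζ k ^ 2) * (X 1 * X 2), C (3 * ζ k) * (X 1 ^ 2 * X 2) + X 1 ^ 3 * X 2, by norm_num, (hcone k).1, (hcone k).2,
        ?_, D₄_translate₂ K (ζ k) (hζ k), fun b => ?_⟩
      · refine Ideal.add_mem _ (Ideal.mul_mem_left _ _ ?_) ?_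
        · have e : I ^ (2 + 1) = I ^ 2 * I := by rw [pow_succ]
          rw [e]
          exact Ideal.mul_mem_mul (Ideal.pow_mem_pow (hX 1) 2) (hX 2)
        · refine Ideal.pow_le_pow_right (by norm_num : 2 + 1 ≤ 4) ?_
          have e : I ^ 4 = I ^ 3 * I := by rw [pow_succ]
          rw [e]
          exact Ideal.mul_mem_mul (Ideal.pow_mem_pow (hX 1) 3) (hX 2)
      · refine D₄_exceptional_oneStep K h2 (hc k) _ _ ?_ ?_ b
        · simpa using (isHomogeneous_C (Fin 3) (3 * ζ k)).mul ((isHomogeneous_X_pow (1 : Fin 3) 2).mul (isHomogeneous_X K (2 : Fin 3)))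
        · have e : I ^ 4 = I ^ 3 * I := by rw [pow_succ]
          rw [e]
          exact Ideal.mul_mem_mul (Ideal.pow_mem_pow (hX 1) 3) (hX 2)

end SecondOrderPoint

end Summit.ResolutionOfSingularities.ResolutionOfSingularities.Cruxes.EquisingularLiftNat.Sections

end
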